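import Mathlib.Analysis.SpecialFunctions.Pow.Real
import Mathlib.Analysis.SpecialFunctions.Sqrt
import HarnessLib

/-!
# Four-terminal hub graphs: the terminal piece is admissible (THEOREM H4, part 4a′)

Support file for crux `stmt-CriticalPhenomena-4575` (`NoHeavyLowerTail`), seat `prim-facecert` gen 21 (`--supports stmt-CriticalPhenomena-4575`);
memo `run/shared/lean/prim/prim-l12/prim-facecert/FINDING-gen21-V4-HUB-GRAPHS.md` §8.  Pure real arithmetic; no sorries, standard axioms.

`termPiece`: the eight quantities of the six terminal pairs among `c u a b` (as functions of the weights `wcu … wab ∈ [0,1]`) are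
nonnegative and satisfy the three one-piece inequalities of `SuperTerminalQuarticHubAlgebra.step` in the `v = √γ` form; with
`x = 1−wcu`, `y = 1−wca`, `z = 1−wcb` they reduce to `√(xyz) ≤ x + y − xy` (`sqrt_xyz_le`) and `xyz ≤ √(xyz)`.  [this work]
-/

namespace Summit.CriticalPhenomena.PercolationContinuityZ3.Theorems.SuperTerminalQuarticTermPiece


/-- AM–GM style bound used for `(E<)` of the terminal piece: `√(xyz) ≤ x + y − xy` on `[0,1]³`. [this work] -/
theorem sqrt_xyz_le {x y z : ℝ} (hx0 : 0 ≤ x) (hx1 : x ≤ 1) (hy0 : 0 ≤ y) (hy1 : y ≤ 1) (hz1 : z ≤ 1) :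
    Real.sqrt (x * y * z) ≤ x + y - x * y := by
  have h1 : Real.sqrt (x * y * z) ≤ Real.sqrt (((x + y) / 2) ^ 2) := by
    refine Real.sqrt_le_sqrt ?_
    nlinarith [sq_nonneg (x - y), mul_le_of_le_one_right (mul_nonneg hx0 hy0) hz1]
  rw [Real.sqrt_sq (by positivity)] at h1
  nlinarith [mul_le_of_le_one_right hx0 hy1, mul_le_of_le_one_left hy0 hx1]

set_option maxHeartbeats 400000 in
/-- **The terminal piece is admissible**: nonnegativity and the three one-piece inequalities (in the `v = √γ` form of
`SuperTerminalQuarticHubAlgebra.step`) for the quantities of the six terminal pairs, as functions of their weights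
`wcu wca wcb wua wub wab ∈ [0,1]`. [this work] -/
theorem termPiece {wcu wca wcb wua wub wab : ℝ} (h1 : 0 ≤ wcu) (h1' : wcu ≤ 1) (h2 : 0 ≤ wca) (h2' : wca ≤ 1) (h3 : 0 ≤ wcb) (h3' : wcb ≤ 1)
    (h4 : 0 ≤ wua) (h4' : wua ≤ 1) (_h5 : 0 ≤ wub) (h5' : wub ≤ 1) (_h6 : 0 ≤ wab) (h6' : wab ≤ 1) :
    let nT := (1 - wcu) * (1 - wca) * (1 - wcb) * (1 - wua) * (1 - wub) * (1 - wab)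
    let pT := (1 - wcu) * (1 - wca) * (1 - wcb) * wua * (1 - wub) * (1 - wab)
    let dT := (1 - wcu) * (1 - wca) * wcb * (1 - wua) * (1 - wub) * (1 - wab)
    let fT := (1 - wcu) * (1 - wca) * wcb * wua * (1 - wub) * (1 - wab)
    let eT := (wcu * (1 - wca) + (1 - wcu) * wca) * (1 - wcb) * (1 - wua) * (1 - wub) * (1 - wab)
    let creT := (1 - wcb) * (1 - wub) * (1 - wab) * (wua + (1 - wua) * wcu * wca)
    let mBT := (1 - wcb) * (1 - wub) * (1 - wab)
    let gT := (1 - wcu) * (1 - wca) * (1 - wcb)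
    (0 ≤ nT ∧ 0 ≤ pT ∧ 0 ≤ dT ∧ 0 ≤ fT ∧ 0 ≤ eT ∧ 0 ≤ creT ∧ 0 ≤ mBT ∧ 0 ≤ gT) ∧
      pT ^ 2 ≤ (pT + fT) * creT * Real.sqrt gT ∧ nT ^ 2 ≤ (nT + dT) * (nT + eT) * Real.sqrt gT ∧
      (nT + pT) ^ 2 ≤ (nT + pT + dT + fT) * mBT * Real.sqrt gT := by
  intro nT pT dT fT eT creT mBT gT
  have c1 : 0 ≤ 1 - wcu := by linarith
  have c2 : 0 ≤ 1 - wca := by linarith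
  have c3 : 0 ≤ 1 - wcb := by linarith
  have c4 : 0 ≤ 1 - wua := by linarith
  have c5 : 0 ≤ 1 - wub := by linarith
  have c6 : 0 ≤ 1 - wab := by linarith
  set X := 1 - wcu with hX
  set Y := 1 - wca with hY
  set Z := 1 - wcb with hZ
  have hX1 : X ≤ 1 := by rw [hX]; linarith
  have hY1 : Y ≤ 1 := by rw [hY]; linarith
  have hZ1 : Z ≤ 1 := by rw [hZ]; linarith
  have hg : 0 ≤ X * Y * Z := by positivity
  have hg1 : X * Y * Z ≤ 1 := by
    calc X * Y * Z ≤ 1 * 1 * 1 := by gcongr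
      _ = 1 := by ring
  have hsq : Real.sqrt (X * Y * Z) * Real.sqrt (X * Y * Z) = X * Y * Z := Real.mul_self_sqrt hg
  have hts : X * Y * Z ≤ Real.sqrt (X * Y * Z) := by
    have h := Real.sqrt_le_sqrt (mul_le_of_le_one_left hg hg1)
    rwa [Real.sqrt_mul_self hg] at h
  have hs0 : 0 ≤ Real.sqrt (X * Y * Z) := Real.sqrt_nonneg _
  have eg : gT = X * Y * Z := by show (1 - wcu) * (1 - wca) * (1 - wcb) = _; rw [hX, hY, hZ]
  rw [eg]
  refine ⟨⟨by positivity, by positivity, by positivity, by positivity, by positivity, by positivity, by positivity, by positivity⟩,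
    ?_, ?_, ?_⟩
  · -- (E=): pT = XYZ·m·wua, pT+fT = XY·m·wua, creT ≥ Z·m·wua, √γ ≥ XYZ  (m = (1-wub)(1-wab))
    have hm : 0 ≤ (1 - wub) * (1 - wab) := by positivity
    have hcre : Z * ((1 - wub) * (1 - wab)) * wua ≤ creT := by
      show Z * ((1 - wub) * (1 - wab)) * wua ≤ (1 - wcb) * (1 - wub) * (1 - wab) * (wua + (1 - wua) * wcu * wca)
      rw [← hZ]; nlinarith [mul_nonneg (mul_nonneg c3 hm) (mul_nonneg (mul_nonneg c4 h1) h2)]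
    have e1 : pT = X * Y * Z * ((1 - wub) * (1 - wab)) * wua := by show _ = _; rw [hX, hY, hZ]; ring
    have e2 : pT + fT = X * Y * ((1 - wub) * (1 - wab)) * wua := by
      show (1 - wcu) * (1 - wca) * (1 - wcb) * wua * (1 - wub) * (1 - wab) + (1 - wcu) * (1 - wca) * wcb * wua * (1 - wub) * (1 - wab) = _
      rw [hX, hY]; ring
    rw [e2, e1]
    have hA : 0 ≤ X * Y * ((1 - wub) * (1 - wab)) * wua := by positivity
    calc (X * Y * Z * ((1 - wub) * (1 - wab)) * wua) ^ 2
        = (X * Y * ((1 - wub) * (1 - wab)) * wua) * (Z * ((1 - wub) * (1 - wab)) * wua) * (X * Y * Z) := by ring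
      _ ≤ (X * Y * ((1 - wub) * (1 - wab)) * wua) * creT * Real.sqrt (X * Y * Z) := by
          have := mul_le_mul (mul_le_mul_of_nonneg_left hcre hA) hts hg (by positivity)
          simpa [mul_assoc] using this
  · -- (E<): nT = XYZ·M, nT+dT = XY·M, nT+eT = Z·M·(X+Y−XY), and √(XYZ) ≤ X+Y−XY  (M = (1-wua)(1-wub)(1-wab))
    have hM : 0 ≤ (1 - wua) * (1 - wub) * (1 - wab) := by positivity
    have e1 : nT = X * Y * Z * ((1 - wua) * (1 - wub) * (1 - wab)) := by show _ = _; rw [hX, hY, hZ]; ring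
    have e2 : nT + dT = X * Y * ((1 - wua) * (1 - wub) * (1 - wab)) := by
      show (1 - wcu) * (1 - wca) * (1 - wcb) * (1 - wua) * (1 - wub) * (1 - wab) +
        (1 - wcu) * (1 - wca) * wcb * (1 - wua) * (1 - wub) * (1 - wab) = _
      rw [hX, hY]; ring
    have e3 : nT + eT = Z * ((1 - wua) * (1 - wub) * (1 - wab)) * (X + Y - X * Y) := by
      show (1 - wcu) * (1 - wca) * (1 - wcb) * (1 - wua) * (1 - wub) * (1 - wab) +
        (wcu * (1 - wca) + (1 - wcu) * wca) * (1 - wcb) * (1 - wua) * (1 - wub) * (1 - wab) = _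
      rw [hX, hY, hZ]; ring
    rw [e2, e3, e1]
    have hq : Real.sqrt (X * Y * Z) ≤ X + Y - X * Y := sqrt_xyz_le c1 hX1 c2 hY1 hZ1
    have hq0 : 0 ≤ X + Y - X * Y := le_trans hs0 hq
    have hkey : X * Y * Z ≤ (X + Y - X * Y) * Real.sqrt (X * Y * Z) := by
      calc X * Y * Z = Real.sqrt (X * Y * Z) * Real.sqrt (X * Y * Z) := hsq.symm
        _ ≤ (X + Y - X * Y) * Real.sqrt (X * Y * Z) := mul_le_mul_of_nonneg_right hq hs0
    calc (X * Y * Z * ((1 - wua) * (1 - wub) * (1 - wab))) ^ 2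
        = (X * Y * ((1 - wua) * (1 - wub) * (1 - wab))) * (Z * ((1 - wua) * (1 - wub) * (1 - wab))) * (X * Y * Z) := by ring
      _ ≤ (X * Y * ((1 - wua) * (1 - wub) * (1 - wab))) * (Z * ((1 - wua) * (1 - wub) * (1 - wab))) *
            ((X + Y - X * Y) * Real.sqrt (X * Y * Z)) := mul_le_mul_of_nonneg_left hkey (by positivity)
      _ = _ := by ring
  · -- (E>): nT+pT = XYZ·m, nT+pT+dT+fT = XY·m, mBT = Z·m  (m = (1-wub)(1-wab)), and XYZ ≤ √(XYZ)
    have e1 : nT + pT = X * Y * Z * ((1 - wub) * (1 - wab)) := by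
      show (1 - wcu) * (1 - wca) * (1 - wcb) * (1 - wua) * (1 - wub) * (1 - wab) +
        (1 - wcu) * (1 - wca) * (1 - wcb) * wua * (1 - wub) * (1 - wab) = _
      rw [hX, hY, hZ]; ring
    have e2 : nT + pT + dT + fT = X * Y * ((1 - wub) * (1 - wab)) := by
      show (1 - wcu) * (1 - wca) * (1 - wcb) * (1 - wua) * (1 - wub) * (1 - wab) +
        (1 - wcu) * (1 - wca) * (1 - wcb) * wua * (1 - wub) * (1 - wab) +
        (1 - wcu) * (1 - wca) * wcb * (1 - wua) * (1 - wub) * (1 - wab) + (1 - wcu) * (1 - wca) * wcb * wua * (1 - wub) * (1 - wab) = _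
      rw [hX, hY]; ring
    have e3 : mBT = Z * ((1 - wub) * (1 - wab)) := by show _ = _; rw [hZ]; ring
    rw [e2, e1, e3]
    calc (X * Y * Z * ((1 - wub) * (1 - wab))) ^ 2
        = (X * Y * ((1 - wub) * (1 - wab))) * (Z * ((1 - wub) * (1 - wab))) * (X * Y * Z) := by ring
      _ ≤ (X * Y * ((1 - wub) * (1 - wab))) * (Z * ((1 - wub) * (1 - wab))) * Real.sqrt (X * Y * Z) :=
          mul_le_mul_of_nonneg_left hts (by positivity)


end Summit.CriticalPhenomena.PercolationContinuityZ3.Theorems.SuperTerminalQuarticTermPiece
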